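import Literature.AlgebraicGeometry.HodgeTheory.CyclicCoverMeridianMonodromy
import Literature.AlgebraicGeometry.HodgeTheory.PicardLefschetzNodalForms
import HarnessLib

/-!
# The local monodromy of a meridian of the cyclic family CENTRED AT A ONE-NODAL BRANCH CURVE is the cyclic
# reflection (Carlson–Toledo 1999 §6 Proposition at the degeneration (kdoublept); one named fact — the
# meridian fact `carlsonToledo1999_meridianMonodromy_isCyclicReflection` RE-CUT to nodal centres)

Family `hodge`, layer `Literature/AlgebraicGeometry/HodgeTheory`. Written by the prover seat `hodge-nonav-prover-Ax`
(g8, cell `hodge-nonav`) for crux K1 `VeryGeneralDeckCommutatorsInHg` of the route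
`Summits/HodgeConjecture/HodgeConjecture/Theses/CyclicUnitaryPowers.lean` (stmt-HodgeConjecture-19544), whose registered
binder `stub_ct99MeridianReflection` is the sibling fact `carlsonToledo1999_meridianMonodromy_isCyclicReflection`
(file `CyclicCoverMeridianMonodromy`).

## Why a second, weaker statement

`carlsonToledo1999_meridianMonodromy_isCyclicReflection` renders CT99 §6 Proposition for EVERY meridian of the
discriminant `V(D)` of the universal family of `p`-cyclic covers of the plane, i.e. for every leashed transversal disc
at every point `y ∈ V(D)` with `∇D(y) ≠ 0` (the tree's `FundamentalGroup.Meridian`). Its conclusion (a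
`(p−1)`-dimensional vanishing space) is the local theory of ONE singularity `y^p = x₁² + x₂²`, so read for every
meridian the statement also contains the classical theorem "a smooth point of the discriminant of plane curves of
degree `p` is a curve with exactly one ordinary node" — which CT99 §1 asserts ("Consider a smooth point `c` of the
discriminant locus. For these `X_c` has exactly one node") and whose proof (the multiplicity of the discriminant
at `c` is the total Milnor number of `X_c`) is a theorem of its own, at cusps not a first-order computation. The
present fact assumes instead, as the print does at (kdoublept), that THE CENTRE OF THE MERIDIAN IS A ONE-NODAL
CURVE: the ternary `p`-form `f_y = Σ_e y_e x^e` of the centre has exactly one singular point in `ℙ²`, an ordinary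
double point (`IsNodalFormWithNodes f_y ![x]` of `PicardLefschetzNodalForms`, Voisin II §2.3.1). It is implied by
the sibling fact (the extra hypothesis is dropped; `…_of_meridianMonodromy` in the Summits consumer) and it
suffices for the consumer: Zariski–van Kampen gives
`π₁(ℂ^N ∖ V(D))` as the normal closure of ONE meridian, the conjugates of a meridian class are classes of meridians
with the same centre, and a meridian centred at an explicit one-nodal `p`-form exists at every base point
(Summits side, `CyclicUnitaryPowersNodalMeridianExists`, `CyclicUnitaryPowersPLPackageOfNodalMeridian`).

## Source, verbatim ([CarlsonToledo1999], arXiv text `paper:arxiv-alg-geom_9708002`)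

* §1 (p0003): "Consider a smooth point `c` of the discriminant locus. For these `X_c` has exactly one node […]
  Consider also a loop `γ = γ_c` defined by following a path `α` from the base point to the edge of a complex disk
  normal to `Δ` and centered at `c`, traveling once around the circle bounding this disk, and then returning to the
  base point along `α` reversed. […] we call these loops (and also their homotopy classes) the meridians of `Δ`."
* §6 (p0013–p0014): "Consider […] a one-parameter family of varieties `X_t` branched along `k`-fold multiples
  `L_t` of hyperplane sections `H_t` acquiring a singularity of the form (kdoublept) `y^k = x₁² + ⋯ + x_n²`";
  "the space of vanishing cycles `V` for the singularity (kdoublept) is `(k−1)`-dimensional and […] the local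
  monodromy transformation is `T = σ_0⊗(−1)⊗⋯⊗(−1)`"; "suppose that `k` is odd. Then the intersection form on
  the space `V` of local vanishing cycles […] is nondegenerate. Consequently `H^{n+1}(Y_õ)` splits orthogonally as
  `V ⊕ V^⊥`. The action on `H^{n+1}(Y_õ)` of the monodromy transformation `T` for the meridian corresponding to
  the degeneration (kdoublept) is given by (TVcxreflectionformula) on `V` and by the identity on `V^⊥`."
  **Proposition.** "Let `T` be the monodromy corresponding to a generic degeneration of the branch locus, as in
  (kdoublept). Then `T` acts on the `i`-th eigenspace of the cyclic automorphism `σ` […] by a complex reflection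
  with eigenvalue `λ_i = (−1)^{n+1} ζ^i`."

## Rendering (case `n = 1` of CT99's `ℙⁿ = ℙ²`, `k = d = p` odd, `3 ≤ p`)

Verbatim the rendering of the sibling fact (module docstring of `CyclicCoverMeridianMonodromy`: base
`cyclicCoverBase p`, family `cyclicCoverFamily p`, identification `e` compatible with the embeddings into `ℙ³`,
covering automorphism `τ` matched with `σ_F^*`, irreducible discriminant equation `D`, coefficient chart `χ`,
tree-meridian `μ` based at `χ [F]`, its loop `γ` read in `S(ℂ)`, conclusion: the rational transport along `γ` exists
and it or its inverse is the cyclic reflection along a non-degenerate `(p−1)`-dimensional `τ`-invariant-free cyclic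
space `ℚ[τ]δ`), with ONE MORE HYPOTHESIS on `μ`: the branch form of its centre, `Σ_e (μ.y)_e x^e`, is nodal with
exactly one node (`∃ x, IsNodalFormWithNodes (Σ_e (μ.y)_e x^e) ![x]`) — the degeneration (kdoublept) for `n = 1`:
the branch CURVE acquires one node `x₁² + x₂²`, the cover the singularity `y^p = x₁² + x₂²`. Which of `σ^*`,
`(σ⁻¹)^*` and which orientation of the meridian circle only exchange `T` and `T⁻¹` (both recorded, as in the sibling).

## What is NOT here

The local analytic theory behind §6 (Milnor fibre of `y^p = uv`, Sebastiani–Thom, the orthogonal splitting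
`V ⊕ V^⊥` of `H²` of the nearby fibre and the triviality of the monodromy on `V^⊥`) — the content of the fact; the
theorem "smooth point of the discriminant ⇒ one node" — NOT needed by the consumer and deliberately not assumed;
the existence of meridians with one-nodal centre and the derivation of the Picard–Lefschetz package (Summits side).

## References

* [CarlsonToledo1999] J. A. Carlson, D. Toledo, Discriminant complements and kernels of monodromy
  representations, Duke Math. J. 97 (1999) 621–648; arXiv alg-geom/9708002, §1 (p0003), §2 (p0004–p0005),
  §6 (kdoublept) and Proposition (p0013–p0014).
* [VoisinHodgeII2003] C. Voisin, Hodge Theory and Complex Algebraic Geometry II, CUP 2003, §2.3.1 (ordinary double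
  points), §3.2.1 (the loop around a degeneration).
* [Shimada2010ZvK] I. Shimada, Lectures on Zariski–van Kampen theorem, arXiv:0906.1074, §3 (leashed discs).
-/

noncomputable section

namespace Literature.AlgebraicGeometry.HodgeTheory

open CategoryTheory
open Literature.AlgebraicTopology.SingularHomology
open Literature.AlgebraicGeometry.Motives Literature.AlgebraicGeometry.Motives.UniversalHypersurface
open Literature.AlgebraicGeometry.HodgeTheory.UniversalHypersurface
open Literature.AlgebraicGeometry.FundamentalGroup

/-! ### The named fact -/

/-- **Named fact (Carlson–Toledo 1999, §6 Proposition at the degeneration (kdoublept); case `n = 1`, `k = d = p`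
odd, `p ≥ 3`): the monodromy of a meridian of the discriminant of the universal family of `p`-cyclic covers of the
plane WHOSE CENTRE IS A ONE-NODAL BRANCH CURVE is the CYCLIC REFLECTION.** For a non-zero ternary `p`-form `f` with
smooth cover `X_F = V(x₃^p − f)`, the identification `e : 𝒴_{[F]} ≅ X_F` compatible with the embeddings into `ℙ³`
and the automorphism `τ` of `H²(𝒴_{[F]}(ℂ); ℚ)` matched by `e` with the deck transformation `σ_F^*`
(`σ_F : x₃ ↦ ζ_p x₃`); an irreducible equation `D` of the discriminant `Δ̃ = {b | x₃^p − f_b singular}`, a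
coefficient chart `χ : S(ℂ) ≃ₜ {D ≠ 0}`, a meridian `μ` of `V(D)` based at `χ [F]` whose CENTRE `y` is the
coefficient vector of a ternary `p`-form `f_y = Σ_e y_e x^e` with exactly one singular point in `ℙ²`, an ordinary
double point ("acquiring a singularity of the form (kdoublept) `y^k = x₁² + x₂²`": the branch curve acquires one
node; `IsNodalFormWithNodes f_y ![x]`), and its loop `γ` read in `S(ℂ)`: the rational transport `T` of `R² u_* ℚ`
along `γ` exists and — UP TO ORIENTATION, `T` or `T⁻¹` — is the cyclic reflection (`τ` on `ℚ[τ]δ`, identity on the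
orthogonal for the cup form `B = transportedTraceForm hX e 2`) along the vanishing space `ℚ[τ]δ` of a vector
`δ ≠ 0` with `Σ_{i<p} τ^i δ = 0`, `dim ℚ[τ]δ = p − 1` ("`(k−1)`-dimensional") and `B` non-degenerate on `ℚ[τ]δ`
("`k` odd […] nondegenerate"). The sibling fact `carlsonToledo1999_meridianMonodromy_isCyclicReflection` is the
same statement for EVERY meridian (every smooth centre) and implies this one
(drop the hypothesis; `CyclicUnitaryPowersPLPackageOfNodalMeridian.…_of_meridianMonodromy`); the present cut does not
contain the theorem "a smooth point of the discriminant is a one-nodal curve" (CT99 §1), which its consumer does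
not need. `-- TODO(general form): k ∣ d, k and d odd, any n: T = (−1)^{n+1}σ on the vanishing space (CT99 §6).`
[cite: CarlsonToledo1999, §6 (kdoublept) and Proposition (held text p0013–p0014), §1 (p0003), §2 (universalcyclic) (p0004–p0005)] -/
def carlsonToledo1999_nodalMeridianMonodromy_isCyclicReflection : Prop :=
  ∀ ⦃p : ℕ⦄ [NeZero p], Odd p → 3 ≤ p →
    ∀ (f : MvPolynomial (Fin 3) ℂ), f.IsHomogeneous p → f ≠ 0 →
    ∀ (hX : IsSmoothProjective 2 (SmoothHypersurface.hypersurface (cyclicCoverForm p f)))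
      (e : fiberOver (cyclicCoverFamily p) (cyclicCoverPoint p f) ≅
        SmoothHypersurface.hypersurface (cyclicCoverForm p f)), IsCompatibleFibreIso p e →
    ∀ (τ : bettiCohomology (fiberOver (cyclicCoverFamily p) (cyclicCoverPoint p f)) 2 ≃ₗ[ℚ]
        bettiCohomology (fiberOver (cyclicCoverFamily p) (cyclicCoverPoint p f)) 2),
      (∀ (ha : deckUnit p ∈ diagonalStabilizer (cyclicCoverForm p f))
          (x : bettiCohomology (fiberOver (cyclicCoverFamily p) (cyclicCoverPoint p f)) 2),
          BettiUniverse.pullEquiv e 2 (τ x) =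
            BettiUniverse.pull (diagonalAut (cyclicCoverForm p f) ha) 2 (BettiUniverse.pullEquiv e 2 x)) →
    ∀ (D : MvPolynomial (TernaryIndex p) ℂ), Irreducible D → IsDiscriminantEquation p D →
    ∀ (χ : ComplexPoints (cyclicCoverBase p) ≃ₜ affineHypersurfaceComplement ![D]), IsCoefficientChart p D χ →
    ∀ (μ : Meridian ![D] (χ (cyclicCoverPoint p f)) 0),
      (∃ x : Fin 3 → ℂ, IsNodalFormWithNodes (n := 1)
        (∑ e : TernaryIndex p, MvPolynomial.monomial e.1 (μ.y e)) ![x]) →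
    ∀ (γ : Path (cyclicCoverPoint p f) (cyclicCoverPoint p f)), (∀ θ, χ (γ θ) = μ.loop θ) →
    ∃ (T : bettiCohomology (fiberOver (cyclicCoverFamily p) (cyclicCoverPoint p f)) 2 ≃ₗ[ℚ]
          bettiCohomology (fiberOver (cyclicCoverFamily p) (cyclicCoverPoint p f)) 2)
      (δ : bettiCohomology (fiberOver (cyclicCoverFamily p) (cyclicCoverPoint p f)) 2),
      IsRatTransport (cyclicCoverFamily p) 2 (cyclicCoverFamily_locallyTrivial p) (cyclicCoverLoopClass p γ) T ∧
      δ ≠ 0 ∧ (∑ i ∈ Finset.range p, (τ ^ i) δ) = 0 ∧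
      Module.finrank ℚ (cyclicSpan τ δ) = p - 1 ∧
      (∀ x ∈ cyclicSpan τ δ, (∀ y ∈ cyclicSpan τ δ, transportedTraceForm hX e 2 x y = 0) → x = 0) ∧
      (IsCyclicReflection (transportedTraceForm hX e 2) τ δ T ∨
        IsCyclicReflection (transportedTraceForm hX e 2) τ δ T⁻¹)

end Literature.AlgebraicGeometry.HodgeTheory

end
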